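import Mathlib
import Summits.NavierStokesRegularity.NavierStokesRegularity.Theorems.ThreadingFluxHorizonTowerZonalBridge
import HarnessLib

/-!
# Crux `PoloidalLiouville` (stmt-NavierStokesRegularity-1222, W1), crux idea «steady-centre-sieve» (ns-idea-15):
# ORDER OF VANISHING of an analytic germ — lowest homogeneous Taylor term with `O(‖y‖^{k+1})` remainder

Support file (`--supports stmt-NavierStokesRegularity-1222`, helper).  Experiment cell `ns-wall-extremal`, width hand
ns-wall-eng-5 g6.  0 kit.  Pure Mathlib-wrapping infrastructure: the layer (α)+(δ) of ns-wall-eng-3 g3's typed L1 checkpoint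
(HOME INBOX 2026-08-29T02:48:30Z (C)) for `CentreJet.TriaxialToroidalJetRigidity` (`Cruxes/PoloidalLiouville/CentreJetSketch.lean`
l.317: «lowest homogeneous component of an analytic jet»), listed as missing infrastructure (i) in ns-wall-eng-5 g5's HANDOFF.

For `f : E → F` analytic at `x₀` (`E` a real normed space, `F` complete) write the DIAGONAL TAYLOR TERMS
`D_n(y) := (n!)⁻¹ • iteratedFDeriv ℝ n f x₀ (y, …, y)`.

* `AnalyticOrder.taylor_isBigO` — `f(x₀ + y) − Σ_{n<N} D_n(y) = O(‖y‖^N)` at `y → 0`, every `N`;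
* `AnalyticOrder.diag_smul`, `contDiff_diag` — `D_n(c•y) = cⁿ D_n(y)`, `D_n` is smooth;
* `AnalyticOrder.eventuallyEq_zero_of_diag_eq_zero`, `eqOn_zero_of_diag_eq_zero` — (δ) all diagonal terms vanish ⇒ `f`
  is locally zero ⇒ zero on a preconnected domain of analyticity (identity principle);
* `AnalyticOrder.exists_order` — (α) if `f` is not locally zero there is a least `k` with `D_k ≢ 0`; all `D_n`, `n < k`, vanish
  identically and `f(x₀ + y) = D_k(y) + O(‖y‖^{k+1})`;
* `AnalyticOrder.eq_zero_of_homogeneous_of_isBigO` — a continuous `k`-homogeneous map that is `O(‖y‖^{k+1})` at `0` is zero;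
  hence `AnalyticOrder.diag_eq_zero_of_isBigO` — (α3) `f(x₀ + y) = O(‖y‖^m)` forces `D_n ≡ 0` for `n < m` (so the order is `≥ m`);
* `AnalyticOrder.exists_mvPolynomial_diag` — (α2) on `ℝ³`, for scalar `f`, each `D_n` is a homogeneous `MvPolynomial (Fin 3) ℝ`
  of degree `n` (ns-wall-eng-5 g4's `Zonal.exists_mvPolynomial_of_homogeneous`).

HONEST FRAME: infrastructure about analytic germs; closes no crux or sketch Prop; `PoloidalLiouville` (1222) and NS regularity OPEN.
-/

-- the summit and its single problem share the name (D-0017 nested layout)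
set_option linter.dupNamespace false

noncomputable section

namespace Summit.NavierStokesRegularity.NavierStokesRegularity.Theorems.PoloidalLiouville.AnalyticOrder

open Set Function Filter Topology Metric Asymptotics
open scoped Topology Nat

section General

variable {E F : Type*} [NormedAddCommGroup E] [NormedSpace ℝ E] [NormedAddCommGroup F] [NormedSpace ℝ F]
  [CompleteSpace F] {f : E → F} {x₀ : E}

/-- The diagonal of the power series of an analytic germ is `(n!)⁻¹ Dⁿf(x₀)[y,…,y]`. -/
theorem coeff_diag_eq {p : FormalMultilinearSeries ℝ E F} {r : ENNReal} (h : HasFPowerSeriesOnBall f p x₀ r)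
    (n : ℕ) (y : E) :
    p n (fun _ => y) = ((n ! : ℝ)⁻¹) • iteratedFDeriv ℝ n f x₀ (fun _ => y) := by
  rw [← h.factorial_smul y n, ← Nat.cast_smul_eq_nsmul ℝ, smul_smul,
    inv_mul_cancel₀ (Nat.cast_ne_zero.mpr n.factorial_ne_zero), one_smul]

/-- **Taylor's formula, `O`-form, in terms of iterated derivatives**: for `f` analytic at `x₀` and every `N`,
`f(x₀ + y) − Σ_{n<N} (n!)⁻¹ Dⁿf(x₀)[y,…,y] = O(‖y‖^N)` as `y → 0`. -/
theorem taylor_isBigO (hf : AnalyticAt ℝ f x₀) (N : ℕ) :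
    (fun y : E => f (x₀ + y) - ∑ n ∈ Finset.range N, ((n ! : ℝ)⁻¹) • iteratedFDeriv ℝ n f x₀ (fun _ => y))
      =O[𝓝 0] fun y : E => ‖y‖ ^ N := by
  obtain ⟨p, r, hp⟩ := hf
  have h := (hp.hasFPowerSeriesAt).isBigO_sub_partialSum_pow N
  refine h.congr' (Eventually.of_forall fun y => ?_) EventuallyEq.rfl
  simp only [FormalMultilinearSeries.partialSum, coeff_diag_eq hp]

omit [CompleteSpace F] in
/-- Homogeneity of the diagonal terms: `Dⁿf(x₀)[cy,…,cy] = cⁿ Dⁿf(x₀)[y,…,y]`. -/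
theorem diag_smul (n : ℕ) (c : ℝ) (y : E) :
    iteratedFDeriv ℝ n f x₀ (fun _ => c • y) = c ^ n • iteratedFDeriv ℝ n f x₀ (fun _ => y) := by
  have h := (iteratedFDeriv ℝ n f x₀).map_smul_univ (fun _ : Fin n => c) (fun _ => y)
  simpa using h

omit [CompleteSpace F] in
/-- The diagonal terms are smooth functions of `y`. -/
theorem contDiff_diag (n : ℕ) {m : WithTop ℕ∞} :
    ContDiff ℝ m (fun y : E => iteratedFDeriv ℝ n f x₀ (fun _ => y)) :=
  (iteratedFDeriv ℝ n f x₀).contDiff.comp (contDiff_pi.mpr fun _ => contDiff_id)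

/-- **(δ) Formally zero ⇒ locally zero**: if every diagonal Taylor term of an analytic germ vanishes identically, the germ is
zero near `x₀`. -/
theorem eventuallyEq_zero_of_diag_eq_zero (hf : AnalyticAt ℝ f x₀)
    (h0 : ∀ (n : ℕ) (y : E), iteratedFDeriv ℝ n f x₀ (fun _ => y) = 0) : f =ᶠ[𝓝 x₀] 0 := by
  obtain ⟨p, r, hp⟩ := hf
  filter_upwards [hp.hasFPowerSeriesAt.eventually_hasSum_sub] with z hz
  have hzero : (fun n : ℕ => p n fun _ : Fin n => z - x₀) = fun _ => 0 := by
    funext n; rw [coeff_diag_eq hp, h0, smul_zero]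
  rw [hzero] at hz
  exact hz.unique hasSum_zero

/-- **(δ) on a domain**: an analytic function on a preconnected set `U ∋ x₀` all of whose diagonal Taylor terms at `x₀` vanish is
zero on `U` (identity principle). -/
theorem eqOn_zero_of_diag_eq_zero {U : Set E} (hf : AnalyticOnNhd ℝ f U) (hU : IsPreconnected U) (hx₀ : x₀ ∈ U)
    (h0 : ∀ (n : ℕ) (y : E), iteratedFDeriv ℝ n f x₀ (fun _ => y) = 0) : EqOn f 0 U :=
  hf.eqOn_zero_of_preconnected_of_eventuallyEq_zero hU hx₀ (eventuallyEq_zero_of_diag_eq_zero (hf x₀ hx₀) h0)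

/-- **(α) The order of vanishing.**  An analytic germ that is not locally zero has a least `k` whose diagonal Taylor term
`D_k(y) = (k!)⁻¹ Dᵏf(x₀)[y,…,y]` is not identically zero; all lower diagonal terms vanish identically, and
`f(x₀ + y) = D_k(y) + O(‖y‖^{k+1})`. -/
theorem exists_order (hf : AnalyticAt ℝ f x₀) (hne : ¬ f =ᶠ[𝓝 x₀] 0) :
    ∃ k : ℕ, (∀ n < k, ∀ y : E, iteratedFDeriv ℝ n f x₀ (fun _ => y) = 0)
      ∧ (∃ y : E, iteratedFDeriv ℝ k f x₀ (fun _ => y) ≠ 0)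
      ∧ (fun y : E => f (x₀ + y) - ((k ! : ℝ)⁻¹) • iteratedFDeriv ℝ k f x₀ (fun _ => y))
          =O[𝓝 0] fun y : E => ‖y‖ ^ (k + 1) := by
  classical
  have hex : ∃ k : ℕ, ∃ y : E, iteratedFDeriv ℝ k f x₀ (fun _ => y) ≠ 0 := by
    by_contra hcon
    push Not at hcon
    exact hne (eventuallyEq_zero_of_diag_eq_zero hf hcon)
  refine ⟨Nat.find hex, fun n hn y => ?_, Nat.find_spec hex, ?_⟩
  · have := Nat.find_min hex hn
    push Not at this
    exact this y
  · have hT := taylor_isBigO hf (Nat.find hex + 1)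
    refine hT.congr' (Eventually.of_forall fun y => ?_) EventuallyEq.rfl
    dsimp only
    rw [Finset.sum_range_succ, Finset.sum_eq_zero fun n hn => ?_, zero_add]
    have hlt : n < Nat.find hex := Finset.mem_range.mp hn
    have := Nat.find_min hex hlt
    push Not at this
    rw [this y, smul_zero]

omit [CompleteSpace F] in
/-- A `k`-homogeneous map that is `O(‖y‖^{k+1})` at the origin vanishes identically. -/
theorem eq_zero_of_homogeneous_of_isBigO {P : E → F} {k : ℕ} (hhom : ∀ (c : ℝ) (y : E), P (c • y) = c ^ k • P y)
    (hO : P =O[𝓝 0] fun y : E => ‖y‖ ^ (k + 1)) (y : E) : P y = 0 := by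
  obtain ⟨C, hC⟩ := hO.bound
  -- along the ray `t ↦ t • y`, `t → 0⁺`: `tᵏ ‖P y‖ ≤ C tᵏ⁺¹ ‖y‖ᵏ⁺¹`
  have hray : Tendsto (fun t : ℝ => t • y) (𝓝[>] 0) (𝓝 0) := by
    have : Tendsto (fun t : ℝ => t • y) (𝓝 0) (𝓝 ((0 : ℝ) • y)) := tendsto_id.smul tendsto_const_nhds
    rw [zero_smul] at this
    exact this.mono_left nhdsWithin_le_nhds
  have hev : ∀ᶠ t : ℝ in 𝓝[>] 0, ‖P y‖ ≤ C * ‖y‖ ^ (k + 1) * t := by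
    filter_upwards [hray.eventually hC, self_mem_nhdsWithin] with t ht ht0
    rw [mem_Ioi] at ht0
    have h1 : ‖P (t • y)‖ = t ^ k * ‖P y‖ := by
      rw [hhom, norm_smul, norm_pow, Real.norm_of_nonneg ht0.le]
    have h2 : ‖‖t • y‖ ^ (k + 1)‖ = t ^ (k + 1) * ‖y‖ ^ (k + 1) := by
      rw [Real.norm_of_nonneg (by positivity), norm_smul, Real.norm_of_nonneg ht0.le, mul_pow]
    rw [h1, h2] at ht
    have htk : 0 < t ^ k := pow_pos ht0 k
    have : t ^ k * ‖P y‖ ≤ t ^ k * (C * ‖y‖ ^ (k + 1) * t) := by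
      calc t ^ k * ‖P y‖ ≤ C * (t ^ (k + 1) * ‖y‖ ^ (k + 1)) := ht
        _ = t ^ k * (C * ‖y‖ ^ (k + 1) * t) := by ring
    exact le_of_mul_le_mul_left this htk
  -- let `t → 0⁺`
  have hlim : Tendsto (fun t : ℝ => C * ‖y‖ ^ (k + 1) * t) (𝓝[>] 0) (𝓝 0) := by
    have : Tendsto (fun t : ℝ => C * ‖y‖ ^ (k + 1) * t) (𝓝 0) (𝓝 (C * ‖y‖ ^ (k + 1) * 0)) :=
      tendsto_const_nhds.mul tendsto_id
    rw [mul_zero] at this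
    exact this.mono_left nhdsWithin_le_nhds
  have hle : ‖P y‖ ≤ 0 := ge_of_tendsto hlim hev
  exact norm_le_zero_iff.mp hle

/-- **(α3) Order bounds from decay**: if `f(x₀ + y) = O(‖y‖^m)` then every diagonal Taylor term of degree `n < m` vanishes
identically (the order of vanishing is at least `m`). -/
theorem diag_eq_zero_of_isBigO (hf : AnalyticAt ℝ f x₀) {m : ℕ}
    (hO : (fun y : E => f (x₀ + y)) =O[𝓝 0] fun y : E => ‖y‖ ^ m) :
    ∀ n < m, ∀ y : E, iteratedFDeriv ℝ n f x₀ (fun _ => y) = 0 := by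
  classical
  -- induction on `n`: strong form
  intro n
  induction n using Nat.strong_induction_on with
  | _ n ih =>
    intro hn y
    -- the diagonal term of degree `n` is `O(‖y‖^{n+1})`: `D_n = (f − Σ_{j<n} D_j) − (f − Σ_{j≤n} D_j)` and both are small
    have hT := taylor_isBigO hf (n + 1)
    have hlow : ∀ j < n, ∀ z : E, iteratedFDeriv ℝ j f x₀ (fun _ => z) = 0 := fun j hj z => ih j hj (lt_trans hj hn) z
    have hD : (fun z : E => ((n ! : ℝ)⁻¹) • iteratedFDeriv ℝ n f x₀ (fun _ => z)) =O[𝓝 0] fun z : E => ‖z‖ ^ (n + 1) := by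
      have h1 : (fun z : E => f (x₀ + z) - ((n ! : ℝ)⁻¹) • iteratedFDeriv ℝ n f x₀ (fun _ => z))
          =O[𝓝 0] fun z : E => ‖z‖ ^ (n + 1) := by
        refine hT.congr' (Eventually.of_forall fun z => ?_) EventuallyEq.rfl
        dsimp only
        rw [Finset.sum_range_succ, Finset.sum_eq_zero fun j hj => ?_, zero_add]
        rw [hlow j (Finset.mem_range.mp hj) z, smul_zero]
      have h2 : (fun z : E => f (x₀ + z)) =O[𝓝 0] fun z : E => ‖z‖ ^ (n + 1) := by
        refine hO.trans ?_
        refine IsBigO.of_bound' (by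
          filter_upwards [Metric.ball_mem_nhds (0 : E) one_pos] with z hz
          rw [Metric.mem_ball, dist_zero_right] at hz
          rw [norm_pow, norm_pow, norm_norm]
          exact pow_le_pow_of_le_one (norm_nonneg z) hz.le (by omega))
      have h3 := h2.sub h1
      refine h3.congr' (Eventually.of_forall fun z => ?_) EventuallyEq.rfl
      simp only [sub_sub_cancel]
    have hhom : ∀ (c : ℝ) (z : E), ((n ! : ℝ)⁻¹) • iteratedFDeriv ℝ n f x₀ (fun _ => c • z)
        = c ^ n • (((n ! : ℝ)⁻¹) • iteratedFDeriv ℝ n f x₀ (fun _ => z)) := fun c z => by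
      rw [diag_smul, smul_comm]
    have h0 := eq_zero_of_homogeneous_of_isBigO hhom hD y
    have hfac : ((n ! : ℝ)⁻¹) ≠ 0 := inv_ne_zero (Nat.cast_ne_zero.mpr n.factorial_ne_zero)
    exact (smul_eq_zero.mp h0).resolve_left hfac

/-- **(α) with a floor**: an analytic germ that is not locally zero and satisfies `f(x₀ + y) = O(‖y‖^m)` has its order of
vanishing `k ≥ m`. -/
theorem exists_order_ge (hf : AnalyticAt ℝ f x₀) (hne : ¬ f =ᶠ[𝓝 x₀] 0) {m : ℕ}
    (hO : (fun y : E => f (x₀ + y)) =O[𝓝 0] fun y : E => ‖y‖ ^ m) :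
    ∃ k : ℕ, m ≤ k ∧ (∀ n < k, ∀ y : E, iteratedFDeriv ℝ n f x₀ (fun _ => y) = 0)
      ∧ (∃ y : E, iteratedFDeriv ℝ k f x₀ (fun _ => y) ≠ 0)
      ∧ (fun y : E => f (x₀ + y) - ((k ! : ℝ)⁻¹) • iteratedFDeriv ℝ k f x₀ (fun _ => y))
          =O[𝓝 0] fun y : E => ‖y‖ ^ (k + 1) := by
  obtain ⟨k, hlow, ⟨y, hy⟩, hrem⟩ := exists_order hf hne
  refine ⟨k, ?_, hlow, ⟨y, hy⟩, hrem⟩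
  by_contra hlt
  exact hy (diag_eq_zero_of_isBigO hf hO k (lt_of_not_ge hlt) y)

end General

/-! ### Scalar germs on `ℝ³`: the lowest term as a homogeneous `MvPolynomial` -/

section Scalar

open Summit.NavierStokesRegularity.NavierStokesRegularity.Theorems.PoloidalLiouville.HorizonTower (E3)
open Summit.NavierStokesRegularity.NavierStokesRegularity.Theorems.PoloidalLiouville.HorizonTower.Zonal (evalE)

variable {f : E3 → ℝ} {x₀ : E3}

/-- **(α2)** Each diagonal Taylor term of a scalar germ on `ℝ³` is (the evaluation of) a homogeneous polynomial of degree `n`. -/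
theorem exists_mvPolynomial_diag (n : ℕ) :
    ∃ q : MvPolynomial (Fin 3) ℝ, q.IsHomogeneous n ∧
      ∀ y : E3, ((n ! : ℝ)⁻¹) • iteratedFDeriv ℝ n f x₀ (fun _ => y) = evalE q y := by
  have hsm : ContDiff ℝ (⊤ : ℕ∞) (fun y : E3 => ((n ! : ℝ)⁻¹) • iteratedFDeriv ℝ n f x₀ (fun _ => y)) :=
    (contDiff_diag n).const_smul _
  have hhom : ∀ (c : ℝ) (y : E3), ((n ! : ℝ)⁻¹) • iteratedFDeriv ℝ n f x₀ (fun _ => c • y)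
      = c ^ n * (((n ! : ℝ)⁻¹) • iteratedFDeriv ℝ n f x₀ (fun _ => y)) := fun c y => by
    rw [diag_smul, smul_eq_mul, smul_eq_mul, smul_eq_mul]; ring
  exact Summit.NavierStokesRegularity.NavierStokesRegularity.Theorems.PoloidalLiouville.HorizonTower.Zonal.exists_mvPolynomial_of_homogeneous
    hsm hhom

/-- **(α) for scalar germs on `ℝ³`, polynomial form**: an analytic scalar germ that is not locally zero and is `O(‖y‖^m)` has a
NON-ZERO homogeneous polynomial lowest term `q` of degree `k ≥ m` with `f(x₀ + y) = q(y) + O(‖y‖^{k+1})`, all lower diagonal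
Taylor terms vanishing. -/
theorem exists_lowest_mvPolynomial (hf : AnalyticAt ℝ f x₀) (hne : ¬ f =ᶠ[𝓝 x₀] 0) {m : ℕ}
    (hO : (fun y : E3 => f (x₀ + y)) =O[𝓝 0] fun y : E3 => ‖y‖ ^ m) :
    ∃ (k : ℕ) (q : MvPolynomial (Fin 3) ℝ), m ≤ k ∧ q.IsHomogeneous k ∧ q ≠ 0
      ∧ (∀ n < k, ∀ y : E3, iteratedFDeriv ℝ n f x₀ (fun _ => y) = 0)
      ∧ (∀ y : E3, ((k ! : ℝ)⁻¹) • iteratedFDeriv ℝ k f x₀ (fun _ => y) = evalE q y)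
      ∧ (fun y : E3 => f (x₀ + y) - evalE q y) =O[𝓝 0] fun y : E3 => ‖y‖ ^ (k + 1) := by
  obtain ⟨k, hmk, hlow, ⟨y, hy⟩, hrem⟩ := exists_order_ge hf hne hO
  obtain ⟨q, hq, hqe⟩ := exists_mvPolynomial_diag (f := f) (x₀ := x₀) k
  refine ⟨k, q, hmk, hq, ?_, hlow, hqe, ?_⟩
  · intro hq0
    apply hy
    have h := hqe y
    have h0 : evalE q y = 0 := by
      rw [hq0]
      simp [Summit.NavierStokesRegularity.NavierStokesRegularity.Theorems.PoloidalLiouville.HorizonTower.Zonal.evalE]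
    rw [h0, smul_eq_zero] at h
    exact h.resolve_left (inv_ne_zero (Nat.cast_ne_zero.mpr k.factorial_ne_zero))
  · refine hrem.congr' (Eventually.of_forall fun z => ?_) EventuallyEq.rfl
    dsimp only
    rw [hqe z]

end Scalar

end Summit.NavierStokesRegularity.NavierStokesRegularity.Theorems.PoloidalLiouville.AnalyticOrder
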